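import Mathlib

/-!
# Solo (informed) rung s26/3: the norm element of a cyclic group of prime order mod `p`

In the genus theory of the Kummer extension `L = K(η^{1/p})/K` (cyclic of degree `p`,
`G = ⟨g⟩`) the composite `j ∘ N_{L/K}` acts on the `p`-torsion class module `M = Cl(L)[p]`
as the norm element `∑_{i<p} gⁱ`.  Over `𝔽_p` this element equals `(g - 1)^{p-1}`; hence it
kills every Jordan strand of `T = g - 1` of length at most `p - 1`, i.e. the corresponding
classes of `K` capitulate in `L` (paper §16.13(h)(5′), "two-strand model").  The third lemma
is the combinatorial shadow of the eigenvalue bookkeeping: on a strand whose top has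
`Δ`-eigenvalue `ω^t` (`t ∈ {3, 5}`) and whose length is at most `7`, the `Δ`-invariant spots
(eigenvalue `ω^{t+d} = 1` at depth `d`) occur at the single depth `d = 6 - t`, so unramified
Kummer classes over a standard field have cell-degree `1` (package) or `3` (cubic) only.
-/

namespace Summit.Langlands.Langlands.Theorems

open Polynomial Finset

/-- In `𝔽_p[X]`: `∑_{i<p} (X+1)^i = X^{p-1}` (put `X = g - 1`: the norm element of a cyclic
group of order `p` is `(g-1)^{p-1}` modulo `p`). -/
theorem soloInformed_norm_element_mod_p (p : ℕ) [hp : Fact p.Prime] :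
    (∑ i ∈ range p, ((X : (ZMod p)[X]) + 1) ^ i) = X ^ (p - 1) := by
  have h := geom_sum_mul ((X : (ZMod p)[X]) + 1) p
  rw [add_sub_cancel_right, add_pow_char, one_pow, add_sub_cancel_right] at h
  have hX : (X : (ZMod p)[X]) ≠ 0 := X_ne_zero
  apply mul_right_cancel₀ hX
  rw [h, ← pow_succ, Nat.sub_add_cancel hp.out.one_le]

/-- The norm element kills strands of length `≤ p - 1`: if `(g-1)^ℓ v = 0` with `ℓ ≤ p - 1`
for an endomorphism `g` of an `𝔽_p`-module, then `(∑_{i<p} gⁱ) v = 0`. -/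
theorem soloInformed_norm_kills_short_strand (p : ℕ) [Fact p.Prime] {V : Type*}
    [AddCommGroup V] [Module (ZMod p) V] (g : Module.End (ZMod p) V) (v : V) (ℓ : ℕ)
    (hℓ : ℓ ≤ p - 1) (hv : ((g - 1) ^ ℓ) v = 0) :
    (∑ i ∈ range p, g ^ i) v = 0 := by
  have key : (∑ i ∈ range p, g ^ i) = (g - 1) ^ (p - 1) := by
    have := congrArg (aeval (R := ZMod p) (g - 1)) (soloInformed_norm_element_mod_p p)
    simpa [map_sum, map_pow, aeval_X, sub_add_cancel] using this
  obtain ⟨m, hm⟩ := Nat.exists_eq_add_of_le hℓ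
  rw [key, hm, add_comm, pow_add, Module.End.mul_apply, hv, map_zero]

/-- Spots: on a strand with top eigenvalue exponent `t ∈ {3,5}` (mod `6`) and length `ℓ ≤ 7`,
the depths `d < ℓ` with `t + d ≡ 0 (mod 6)` form a subset of `{6 - t}`; so there is at most
one invariant spot, and it exists iff `ℓ > 6 - t` (package iff `ℓ₅ ≥ 2`, cubic iff `ℓ₃ ≥ 4`). -/
theorem soloInformed_strand_spots :
    ∀ t ∈ ({3, 5} : Finset ℕ), ∀ ℓ ≤ 7,
      (range ℓ).filter (fun d => (t + d) % 6 = 0) ⊆ {6 - t} ∧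
      ((range ℓ).filter (fun d => (t + d) % 6 = 0)).card = (if 6 - t < ℓ then 1 else 0) := by
  decide

end Summit.Langlands.Langlands.Theorems
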